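import Literature.MathematicalPhysics.QuantumFieldTheory.Balaban1983to89.B12Eq213Body268
import Literature.MathematicalPhysics.QuantumFieldTheory.Balaban1983to89.B13

/-!
# `Balaban1983to89.B12Eq213CutoffDependence` — T. Bałaban, *Renormalization group approach to lattice gauge field
theories. I*, Commun. Math. Phys. **109** (1987) 249–301 [Balaban1987RG1], (2.9) p. 266 with (2.13) p. 268 and p. 263
ll. 22–28; T. Bałaban, *Renormalization group approach to lattice gauge field theories. II. Cluster expansions*, Commun.
Math. Phys. **116** (1988) 1–22 [Balaban1988RG2Cluster], (2.22) p. 16: **how the new term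
`𝐄^{(k+1)}(g_k, U_{k+1}) = log ∫dμ_{C^{(k)}}(B) χ_k exp[𝐏^{(k)} + {…}]` of the body of record (`B12Eq213Body268.FluctData.newTerm`)
depends on the small-field CUT-OFF `χ_k` — monotone in the cut-off, and the LARGE-FIELD SMALLNESS of the cut-off channel by
the (2.22) Chebyshev device, kernel-checked on the body**

statement-level skeleton of published theorems with citation tags; proofs where landed; nothing here is a claim about
the Yang–Mills mass gap

PDF held: `paper:balaban1987-cmp109-rg-i-small-field` (journal page = PDF page + 248; p. 266 [PDF 18], p. 263 [PDF 15],
p. 268 [PDF 20] re-read this session from the text layer); `paper:balaban1988-cmp116-rg-ii-cluster` ((2.22) p. 16, through the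
tree's certified reading `B13.indicator_le_exp_222`).

CITATION HEADER / WHAT IS REPRODUCED (cell `pub-ymgap`, HUMAN RULING D-0062 Track A, seat `pub-ymgap-dag-n22-b` = the
FIRST-MISSING-ESTIMATE seat of DAG node N22 = spine estimate NE9; second module of the body-level chain after
`B12Eq213CouplingDependence` (p409146); a NEW LEAF over r20's `B12Eq213Body268` ((2.13) WITH BODY) and the cell's `B13`
((2.22) certified), nothing there modified).

THE PRINT.  [I] p. 266 [PDF 18] (2.9): *«Finally we can define the characteristic function χ_k = Π χ({|B′(b)| < ε₁}). (2.9)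
Another possibility is to take g_k/γ_kε₁ instead of ε₁, where γ_k = C log(L^kε)^{−1} with C sufficiently large. It has the
advantage that the functions 𝐄^{(j)}, β_j are analytic functions of the effective coupling constants, but it has some
disadvantages in perturbative calculations also. We have formulated the implications of both possibilities in the inductive
description.»*; p. 267: *«Next we make the scaling transformation B = g_kB′»* — so that in the integration variable of (2.13) the
cut-off is `|B(b)| < ε₁g_k⁻¹` ([II] (1.34) p. 9 *«{B : |B| < ε₁g_k^{−1} on Y}»*): THE CUT-OFF IS THE SECOND CHANNEL THROUGH
WHICH THE LAST COUPLING `g_k` ENTERS the new term (the first being the exponent, module `B12Eq213CouplingDependence`), and the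
one print ties to the dichotomy of p. 263 ll. 22–28 *«It is a C^∞-function of g_{j−1} ∈ [0, γ], (or analytic)»*.  [II] p. 16
(2.22): *«χ_{k,Y₀}(B)χᶜ_{k,P}(B) ≤ exp(−½γ₂(ε₁²/g_k²)|P| + ½γ₂‖PB‖²)»* (Chebyshev on each large-field bond; γ₂ small).  NOTHING
quantitative about the cut-off dependence of `𝐄^{(k+1)}` is printed.

WHAT THIS MODULE DOES (THEOREMS ONLY; no definition, no named fact).  For the BODY `FluctData.newTerm D g U =
log ∫ χ_U e^{𝐏 + {…}} dμ_U` of (2.13) — an ARBITRARY datum `D : FluctData X` — and a SECOND CUT-OFF `χ′` dominating `χ`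
(`χ ≤ χ′ ≤ 1`, the same measures and exponent, written `{ D with χ := χ′, … }` so that everything else is literally shared):
* §1 (engine, `private`): `∫ χ e^{F} ≤ ∫ χ′ e^{F}`; `log ∫ χ′e^{F} − log ∫ χe^{F} ≤ (∫ (χ′ − χ)e^{F}) ∕ (∫ χe^{F})` (from
  `log x ≤ x − 1`); `1 − Π_{b∈S}(1 − a_b) ≤ Σ_{b∈S} a_b` for `a_b ∈ [0, 1]`.
* §2 **MONOTONICITY IN THE CUT-OFF** `newTerm_mono_of_chi_le` (a wider small-field window gives a larger new term) and the
  **CUT-OFF CHANNEL BOUND** `newTerm_sub_newTerm_le_of_chi_le`: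
  `0 ≤ 𝐄′^{(k+1)}(g, U) − 𝐄^{(k+1)}(g, U) ≤ (∫ (χ′_U − χ_U) e^{𝐏+{…}} dμ_U) ∕ (∫ χ_U e^{𝐏+{…}} dμ_U)`.
* §3 **THE (2.22) DEVICE ON THE BODY** `newTerm_sub_newTerm_le_largeField`: if the window difference is supported on the large
  field of a finite family of bond variables `ℓ_b`, `χ′ − χ ≤ χ′·Σ_{b∈S} 1{r ≤ |ℓ_b|}` (true for nested product cut-offs,
  `gap_of_nested_product`), then for every `γ₂ ≥ 0`
  `𝐄′^{(k+1)}(g, U) − 𝐄^{(k+1)}(g, U) ≤ e^{−½γ₂r²} · (Σ_{b∈S} ∫ χ′_U e^{𝐏+{…}} e^{½γ₂ℓ_b²} dμ_U) ∕ (∫ χ_U e^{𝐏+{…}} dμ_U)` — the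
  LARGE-FIELD FACTOR `e^{−½γ₂r²}` of (2.22) (`r = ε₁g_k⁻¹` in the integration variable: `e^{−½γ₂ε₁²/g_k²}`, flat to all orders at
  `g_k = 0`) times TILTED EXPONENTIAL MOMENTS, whose control is the (2.15)–(2.25)-type Gaussian domination of [II] (NOT done here).
* §4 **THE LAST COUPLING THROUGH THE CUT-OFF** `newTerm_mono_radius` ∕ `newTerm_sub_newTerm_le_radius`: for product
  cut-offs `Π_{b∈S} 1{|ℓ_b| < r}` at two radii `r′ ≤ r` (couplings `g′ ≥ g` at `r = ε₁/g`) the new term is monotone in the radius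
  and the increment is `≤ e^{−½γ₂r′²} · (tilted moments) ∕ (∫ χ^{(r′)} e^{…})`.
HONEST READING: body-level first link of the SECOND `g_k`-channel of NE9's last-coupling modulus; the activity-level (localized)
version with Bałaban's Gaussian letters is the cell's `Support/NE9CutoffShell` ∕ `NE9FormGaussian` (hypothesis shapes, instance
0∕1); what makes any of this «Bałaban's 𝐄^{(k+1)}» is the object W1 (NODE 00 ∕ substrate S-U3), not in the tree.

WHAT IS *NOT* HERE: the Gaussian estimate of the tilted moments ((2.15)–(2.25)); smoothness in `r` (a hard cut-off's
`r`-derivative is a surface term — not typed); the alternative cut-off `g_k/γ_kε₁` (tree: `B12SmallFieldDomain259.chiFluctAlt`);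
localization.  Every theorem is elementary real analysis about the typed body; the `[cite: …]` tags locate the printed objects and
sentences.  HONEST FRAMING: count-neutral Track-A side module; NOT a discharge of node N22; one finite T⁴ programme at fixed ε,
Bałaban AS PRINTED with locators; nothing continuum ∕ ℝ⁴ ∕ OS ∕ mass-gap ∕ Clay.
-/

noncomputable section

namespace Literature.MathematicalPhysics.QuantumFieldTheory.Balaban1983to89.B12Eq213CutoffDependence

open _root_.MeasureTheory
open scoped BigOperators
open Literature.MathematicalPhysics.QuantumFieldTheory.Balaban1983to89
open Literature.MathematicalPhysics.QuantumFieldTheory.Balaban1983to89.B12Eq213Body268 (FluctData)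

/-! ## §1. Engine (private): two windows `χ ≤ χ′` under one exponent -/

section Engine

variable {Ω : Type*} [MeasurableSpace Ω] {μ : Measure Ω}

/-- A wider window gives a larger small-field integral. [folklore] -/
private theorem integral_window_mono {χ χ' F : Ω → ℝ}
    (hF : Integrable (fun ω => χ ω * Real.exp (F ω)) μ) (hF' : Integrable (fun ω => χ' ω * Real.exp (F ω)) μ)
    (hle : ∀ ω, χ ω ≤ χ' ω) :
    ∫ ω, χ ω * Real.exp (F ω) ∂μ ≤ ∫ ω, χ' ω * Real.exp (F ω) ∂μ :=
  integral_mono hF hF' fun ω => mul_le_mul_of_nonneg_right (hle ω) (Real.exp_nonneg _)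

/-- `log a′ − log a ≤ (a′ − a)/a` for `0 < a ≤ a′` (from `log x ≤ x − 1`). [folklore] -/
private theorem log_sub_log_le_div {a a' : ℝ} (ha : 0 < a) (haa : a ≤ a') :
    Real.log a' - Real.log a ≤ (a' - a) / a := by
  have ha' : 0 < a' := ha.trans_le haa
  rw [← Real.log_div ha'.ne' ha.ne']
  have h := Real.log_le_sub_one_of_pos (div_pos ha' ha)
  calc Real.log (a' / a) ≤ a' / a - 1 := h
    _ = (a' - a) / a := by field_simp

/-- The window-difference integral splits: `∫ χ′e^{F} − ∫ χe^{F} = ∫ (χ′ − χ)e^{F}`. [folklore] -/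
private theorem integral_window_sub {χ χ' F : Ω → ℝ}
    (hF : Integrable (fun ω => χ ω * Real.exp (F ω)) μ) (hF' : Integrable (fun ω => χ' ω * Real.exp (F ω)) μ) :
    ∫ ω, χ' ω * Real.exp (F ω) ∂μ - ∫ ω, χ ω * Real.exp (F ω) ∂μ = ∫ ω, (χ' ω - χ ω) * Real.exp (F ω) ∂μ := by
  rw [← integral_sub hF' hF]
  refine integral_congr_ae (Filter.Eventually.of_forall fun ω => ?_)
  ring

/-- `1 − Π_{b∈S}(1 − a_b) ≤ Σ_{b∈S} a_b` for `a_b ∈ [0, 1]` (union bound). [folklore] -/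
private theorem one_sub_prod_one_sub_le_sum {ι : Type*} (S : Finset ι) (a : ι → ℝ) (h0 : ∀ b ∈ S, 0 ≤ a b)
    (h1 : ∀ b ∈ S, a b ≤ 1) : 1 - ∏ b ∈ S, (1 - a b) ≤ ∑ b ∈ S, a b := by
  classical
  induction S using Finset.induction_on with
  | empty => simp
  | insert b S hb ih =>
    rw [Finset.prod_insert hb, Finset.sum_insert hb]
    have h0b : 0 ≤ a b := h0 b (Finset.mem_insert_self b S)
    have h1b : a b ≤ 1 := h1 b (Finset.mem_insert_self b S)
    have hP0 : 0 ≤ ∏ x ∈ S, (1 - a x) :=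
      Finset.prod_nonneg fun x hx => sub_nonneg.2 (h1 x (Finset.mem_insert_of_mem hx))
    have hP1 : ∏ x ∈ S, (1 - a x) ≤ 1 :=
      Finset.prod_le_one (fun x hx => sub_nonneg.2 (h1 x (Finset.mem_insert_of_mem hx)))
        fun x hx => sub_le_self 1 (h0 x (Finset.mem_insert_of_mem hx))
    have ih' := ih (fun x hx => h0 x (Finset.mem_insert_of_mem hx)) fun x hx => h1 x (Finset.mem_insert_of_mem hx)
    nlinarith

end Engine

/-! ## §2. The new term is monotone in the cut-off; the cut-off channel bound -/

section Window

variable {X : Type*} (D : FluctData X)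

/-- **MONOTONICITY IN THE CUT-OFF.**  A second small-field window `χ′` with `χ_U ≤ χ′_U` (pointwise; `0 ≤ χ′ ≤ 1`), the same
measures and the same exponent `𝐏^{(k)} + {…}`, gives a LARGER new term: `𝐄^{(k+1)}(g, U) ≤ 𝐄′^{(k+1)}(g, U)` (integrable
integrands, positive integral for `χ`). [cite: Balaban1987RG1, (2.9) p.266 and (2.13) p.268] -/
theorem newTerm_mono_of_chi_le (χ' : X → D.𝓑 → ℝ) (h0 : ∀ U B, 0 ≤ χ' U B) (h1 : ∀ U B, χ' U B ≤ 1) {g : ℝ} {U : X}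
    (hint : Integrable (D.integrand g U) (D.μ U))
    (hint' : Integrable (FluctData.integrand { D with χ := χ', χ_nonneg := h0, χ_le_one := h1 } g U) (D.μ U))
    (hpos : 0 < D.integral g U) (hle : ∀ B, D.χ U B ≤ χ' U B) :
    D.newTerm g U ≤ FluctData.newTerm { D with χ := χ', χ_nonneg := h0, χ_le_one := h1 } g U :=
  Real.log_le_log hpos
    (integral_window_mono (μ := D.μ U) (χ := D.χ U) (χ' := χ' U) (F := D.exponent g U) hint hint' hle)

/-- **THE CUT-OFF CHANNEL BOUND.**  Under the same hypotheses
`𝐄′^{(k+1)}(g, U) − 𝐄^{(k+1)}(g, U) ≤ (∫ (χ′_U − χ_U) e^{𝐏+{…}} dμ_U) ∕ (∫ χ_U e^{𝐏+{…}} dμ_U)`: the new term changes by at most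
the RELATIVE WEIGHT OF THE WINDOW DIFFERENCE in the small-field interacting measure. [cite: Balaban1987RG1, (2.9) p.266 and (2.13) p.268] -/
theorem newTerm_sub_newTerm_le_of_chi_le (χ' : X → D.𝓑 → ℝ) (h0 : ∀ U B, 0 ≤ χ' U B) (h1 : ∀ U B, χ' U B ≤ 1)
    {g : ℝ} {U : X} (hint : Integrable (D.integrand g U) (D.μ U))
    (hint' : Integrable (FluctData.integrand { D with χ := χ', χ_nonneg := h0, χ_le_one := h1 } g U) (D.μ U))
    (hpos : 0 < D.integral g U) (hle : ∀ B, D.χ U B ≤ χ' U B) :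
    FluctData.newTerm { D with χ := χ', χ_nonneg := h0, χ_le_one := h1 } g U - D.newTerm g U ≤
      (∫ B, (χ' U B - D.χ U B) * Real.exp (D.exponent g U B) ∂(D.μ U)) / D.integral g U := by
  have hmono := integral_window_mono (μ := D.μ U) (χ := D.χ U) (χ' := χ' U) (F := D.exponent g U) hint hint' hle
  have h := log_sub_log_le_div (a := ∫ B, D.χ U B * Real.exp (D.exponent g U B) ∂(D.μ U))
    (a' := ∫ B, χ' U B * Real.exp (D.exponent g U B) ∂(D.μ U)) hpos hmono
  rw [integral_window_sub (μ := D.μ U) (χ := D.χ U) (χ' := χ' U) (F := D.exponent g U) hint hint'] at h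
  exact h

end Window

/-! ## §3. The (2.22) device on the body: large-field smallness of the cut-off channel -/

section LargeField

variable {X : Type*} (D : FluctData X)

/-- NESTED PRODUCT CUT-OFFS: if `χ_U = χ′_U · Π_{b∈S} 1{|ℓ_b| < r}` (the narrower window adds the small-field conditions of
the bond variables `ℓ_b`, `b ∈ S` — print's product (2.9) over bonds), then the window difference is supported on the large
field: `χ′_U − χ_U ≤ χ′_U · Σ_{b∈S} 1{r ≤ |ℓ_b|}` (union bound). [cite: Balaban1987RG1, (2.9) p.266] -/
theorem gap_of_nested_product {ι : Type*} (S : Finset ι) (ℓ : ι → D.𝓑 → ℝ) (r : ℝ) (χ' : X → D.𝓑 → ℝ)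
    (h0 : ∀ U B, 0 ≤ χ' U B) {U : X}
    (hprod : ∀ B, D.χ U B = χ' U B * ∏ b ∈ S, (if |ℓ b B| < r then (1 : ℝ) else 0)) (B : D.𝓑) :
    χ' U B - D.χ U B ≤ χ' U B * ∑ b ∈ S, (if r ≤ |ℓ b B| then (1 : ℝ) else 0) := by
  rw [hprod B]
  have key : 1 - ∏ b ∈ S, (if |ℓ b B| < r then (1 : ℝ) else 0) ≤ ∑ b ∈ S, (if r ≤ |ℓ b B| then (1 : ℝ) else 0) := by
    have e : ∀ b ∈ S, (if |ℓ b B| < r then (1 : ℝ) else 0) = 1 - (if r ≤ |ℓ b B| then (1 : ℝ) else 0) := by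
      intro b _
      by_cases h : r ≤ |ℓ b B|
      · simp [h, not_lt.2 h]
      · simp [h, not_le.1 h]
    rw [Finset.prod_congr rfl e]
    exact one_sub_prod_one_sub_le_sum S _ (fun b _ => by split_ifs <;> norm_num) fun b _ => by split_ifs <;> norm_num
  have hχ' := h0 U B
  nlinarith

/-- **THE (2.22) DEVICE ON THE BODY — LARGE-FIELD SMALLNESS OF THE CUT-OFF CHANNEL.**  If the window difference is supported on
the large field of finitely many bond variables, `χ′_U − χ_U ≤ χ′_U·Σ_{b∈S} 1{r ≤ |ℓ_b|}` (`0 ≤ r`; e.g. nested product cut-offs,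
`gap_of_nested_product`), then for every `γ₂ ≥ 0` — by the Chebyshev inequality `1{r ≤ |x|} ≤ exp(½γ₂(x² − r²))` certified in the
tree as `B13.indicator_le_exp_222` ([II] (2.22)) —
`𝐄′^{(k+1)}(g, U) − 𝐄^{(k+1)}(g, U) ≤ e^{−½γ₂r²} · (Σ_{b∈S} ∫ χ′_U e^{𝐏+{…}} e^{½γ₂ℓ_b²} dμ_U) ∕ (∫ χ_U e^{𝐏+{…}} dμ_U)`:
the LARGE-FIELD FACTOR times tilted exponential moments (whose Gaussian control, (2.15)–(2.25) of [II], is not done here).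
In the integration variable of (2.13) `r = ε₁g_k⁻¹`, so the factor is `exp(−½γ₂ε₁²/g_k²)`. [cite: Balaban1988RG2Cluster, (2.22) p.16; Balaban1987RG1, (2.9) p.266 and (2.13) p.268] -/
theorem newTerm_sub_newTerm_le_largeField {ι : Type*} (S : Finset ι) (ℓ : ι → D.𝓑 → ℝ) {r γ₂ : ℝ} (hr : 0 ≤ r)
    (hγ : 0 ≤ γ₂) (χ' : X → D.𝓑 → ℝ) (h0 : ∀ U B, 0 ≤ χ' U B) (h1 : ∀ U B, χ' U B ≤ 1) {g : ℝ} {U : X}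
    (hint : Integrable (D.integrand g U) (D.μ U))
    (hint' : Integrable (FluctData.integrand { D with χ := χ', χ_nonneg := h0, χ_le_one := h1 } g U) (D.μ U))
    (hmom : ∀ b ∈ S, Integrable (fun B => χ' U B * Real.exp (D.exponent g U B) * Real.exp (γ₂ / 2 * (ℓ b B) ^ 2)) (D.μ U))
    (hpos : 0 < D.integral g U) (hle : ∀ B, D.χ U B ≤ χ' U B)
    (hgap : ∀ B, χ' U B - D.χ U B ≤ χ' U B * ∑ b ∈ S, (if r ≤ |ℓ b B| then (1 : ℝ) else 0)) :
    FluctData.newTerm { D with χ := χ', χ_nonneg := h0, χ_le_one := h1 } g U - D.newTerm g U ≤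
      Real.exp (-(γ₂ / 2 * r ^ 2)) *
        (∑ b ∈ S, ∫ B, χ' U B * Real.exp (D.exponent g U B) * Real.exp (γ₂ / 2 * (ℓ b B) ^ 2) ∂(D.μ U)) /
        D.integral g U := by
  have hstep := newTerm_sub_newTerm_le_of_chi_le D χ' h0 h1 hint hint' hpos hle
  refine hstep.trans (div_le_div_of_nonneg_right ?_ hpos.le)
  -- pointwise: (χ′ − χ)e^{F} ≤ e^{−½γ₂r²} Σ_b χ′ e^{F} e^{½γ₂ℓ_b²}
  have hpt : ∀ B, (χ' U B - D.χ U B) * Real.exp (D.exponent g U B) ≤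
      Real.exp (-(γ₂ / 2 * r ^ 2)) *
        ∑ b ∈ S, χ' U B * Real.exp (D.exponent g U B) * Real.exp (γ₂ / 2 * (ℓ b B) ^ 2) := by
    intro B
    have hind : ∀ b ∈ S, (if r ≤ |ℓ b B| then (1 : ℝ) else 0) ≤
        Real.exp (-(γ₂ / 2 * r ^ 2)) * Real.exp (γ₂ / 2 * (ℓ b B) ^ 2) := by
      intro b _
      have h := B13.indicator_le_exp_222 (ℓ b B) r γ₂ hγ hr
      calc (if r ≤ |ℓ b B| then (1 : ℝ) else 0) ≤ Real.exp (γ₂ / 2 * ((ℓ b B) ^ 2 - r ^ 2)) := h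
        _ = Real.exp (-(γ₂ / 2 * r ^ 2)) * Real.exp (γ₂ / 2 * (ℓ b B) ^ 2) := by
            rw [← Real.exp_add]; ring_nf
    have hsum : ∑ b ∈ S, (if r ≤ |ℓ b B| then (1 : ℝ) else 0) ≤
        ∑ b ∈ S, Real.exp (-(γ₂ / 2 * r ^ 2)) * Real.exp (γ₂ / 2 * (ℓ b B) ^ 2) := Finset.sum_le_sum hind
    have hw : 0 ≤ χ' U B * Real.exp (D.exponent g U B) := mul_nonneg (h0 U B) (Real.exp_nonneg _)
    calc (χ' U B - D.χ U B) * Real.exp (D.exponent g U B)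
        ≤ (χ' U B * ∑ b ∈ S, (if r ≤ |ℓ b B| then (1 : ℝ) else 0)) * Real.exp (D.exponent g U B) :=
          mul_le_mul_of_nonneg_right (hgap B) (Real.exp_nonneg _)
      _ = (χ' U B * Real.exp (D.exponent g U B)) * ∑ b ∈ S, (if r ≤ |ℓ b B| then (1 : ℝ) else 0) := by ring
      _ ≤ (χ' U B * Real.exp (D.exponent g U B)) *
            ∑ b ∈ S, Real.exp (-(γ₂ / 2 * r ^ 2)) * Real.exp (γ₂ / 2 * (ℓ b B) ^ 2) :=
          mul_le_mul_of_nonneg_left hsum hw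
      _ = Real.exp (-(γ₂ / 2 * r ^ 2)) *
            ∑ b ∈ S, χ' U B * Real.exp (D.exponent g U B) * Real.exp (γ₂ / 2 * (ℓ b B) ^ 2) := by
          rw [Finset.mul_sum, Finset.mul_sum]
          refine Finset.sum_congr rfl fun b _ => ?_
          ring
  have hrhs_int : Integrable (fun B => Real.exp (-(γ₂ / 2 * r ^ 2)) *
      ∑ b ∈ S, χ' U B * Real.exp (D.exponent g U B) * Real.exp (γ₂ / 2 * (ℓ b B) ^ 2)) (D.μ U) :=
    (integrable_finsetSum S fun b hb => hmom b hb).const_mul _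
  have hlhs_int : Integrable (fun B => (χ' U B - D.χ U B) * Real.exp (D.exponent g U B)) (D.μ U) := by
    have h := hint'.sub hint
    refine h.congr (Filter.Eventually.of_forall fun B => ?_)
    simp only [FluctData.integrand_apply, Pi.sub_apply]
    show χ' U B * Real.exp (FluctData.exponent { D with χ := χ', χ_nonneg := h0, χ_le_one := h1 } g U B) -
      D.χ U B * Real.exp (D.exponent g U B) = (χ' U B - D.χ U B) * Real.exp (D.exponent g U B)
    have : FluctData.exponent { D with χ := χ', χ_nonneg := h0, χ_le_one := h1 } g U B = D.exponent g U B := rfl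
    rw [this]; ring
  calc ∫ B, (χ' U B - D.χ U B) * Real.exp (D.exponent g U B) ∂(D.μ U)
      ≤ ∫ B, Real.exp (-(γ₂ / 2 * r ^ 2)) *
          ∑ b ∈ S, χ' U B * Real.exp (D.exponent g U B) * Real.exp (γ₂ / 2 * (ℓ b B) ^ 2) ∂(D.μ U) :=
        integral_mono hlhs_int hrhs_int hpt
    _ = Real.exp (-(γ₂ / 2 * r ^ 2)) *
          ∑ b ∈ S, ∫ B, χ' U B * Real.exp (D.exponent g U B) * Real.exp (γ₂ / 2 * (ℓ b B) ^ 2) ∂(D.μ U) := by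
        rw [integral_const_mul, integral_finsetSum S fun b hb => hmom b hb]

end LargeField

/-! ## §4. The last coupling through the cut-off: product windows at two radii -/

section Radius

variable {X : Type*} (D : FluctData X)

/-- **THE LAST COUPLING THROUGH THE CUT-OFF, MONOTONICITY**: for a datum whose window is the product cut-off
`χ_U = w_U · Π_{b∈S} 1{|ℓ_b| < r′}` and the same datum at a LARGER radius `r ≥ r′` (`χ′_U = w_U · Π_{b∈S} 1{|ℓ_b| < r}`; in the
integration variable of (2.13) `r = ε₁/g_k`, so a larger radius is a SMALLER coupling), the new term is monotone:
`𝐄^{(k+1)}_{r′}(g, U) ≤ 𝐄^{(k+1)}_{r}(g, U)`. [cite: Balaban1987RG1, (2.9) p.266 and (2.13) p.268] -/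
theorem newTerm_mono_radius {ι : Type*} (S : Finset ι) (ℓ : ι → D.𝓑 → ℝ) {r r' : ℝ} (hrr : r' ≤ r)
    (w : X → D.𝓑 → ℝ) (hw0 : ∀ U B, 0 ≤ w U B)
    (χ' : X → D.𝓑 → ℝ) (h0 : ∀ U B, 0 ≤ χ' U B) (h1 : ∀ U B, χ' U B ≤ 1) {g : ℝ} {U : X}
    (hχ : ∀ B, D.χ U B = w U B * ∏ b ∈ S, (if |ℓ b B| < r' then (1 : ℝ) else 0))
    (hχ' : ∀ B, χ' U B = w U B * ∏ b ∈ S, (if |ℓ b B| < r then (1 : ℝ) else 0))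
    (hint : Integrable (D.integrand g U) (D.μ U))
    (hint' : Integrable (FluctData.integrand { D with χ := χ', χ_nonneg := h0, χ_le_one := h1 } g U) (D.μ U))
    (hpos : 0 < D.integral g U) :
    D.newTerm g U ≤ FluctData.newTerm { D with χ := χ', χ_nonneg := h0, χ_le_one := h1 } g U := by
  refine newTerm_mono_of_chi_le D χ' h0 h1 hint hint' hpos fun B => ?_
  rw [hχ B, hχ' B]
  refine mul_le_mul_of_nonneg_left (Finset.prod_le_prod (fun b _ => by split_ifs <;> norm_num) fun b _ => ?_) (hw0 U B)
  by_cases h : |ℓ b B| < r'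
  · simp [h, h.trans_le hrr]
  · simp only [h, if_false]
    split_ifs <;> norm_num

/-- **THE LAST COUPLING THROUGH THE CUT-OFF, LARGE-FIELD SMALLNESS**: in the situation of `newTerm_mono_radius` (with `w ≤ 1`,
`0 ≤ r′`), for every `γ₂ ≥ 0`,
`𝐄^{(k+1)}_{r}(g, U) − 𝐄^{(k+1)}_{r′}(g, U) ≤ e^{−½γ₂r′²} · (Σ_{b∈S} ∫ χ′_U e^{𝐏+{…}} e^{½γ₂ℓ_b²} dμ_U) ∕ (∫ χ_U e^{𝐏+{…}} dμ_U)`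
— with `r′ = ε₁/g′_k ≤ r = ε₁/g_k` the increment of the new term between the couplings `g_k ≤ g′_k` through the cut-off channel
carries the factor `exp(−½γ₂ε₁²/g′_k²)`, flat to all orders in the coupling (print's (2.22) large-field factor), times tilted
moments. [cite: Balaban1988RG2Cluster, (2.22) p.16; Balaban1987RG1, (2.9) p.266, p.263 (clause before (1.18))] -/
theorem newTerm_sub_newTerm_le_radius {ι : Type*} (S : Finset ι) (ℓ : ι → D.𝓑 → ℝ) {r r' γ₂ : ℝ} (hr' : 0 ≤ r')
    (hrr : r' ≤ r) (hγ : 0 ≤ γ₂) (w : X → D.𝓑 → ℝ)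
    (χ' : X → D.𝓑 → ℝ) (h0 : ∀ U B, 0 ≤ χ' U B) (h1 : ∀ U B, χ' U B ≤ 1) {g : ℝ} {U : X}
    (hχ : ∀ B, D.χ U B = w U B * ∏ b ∈ S, (if |ℓ b B| < r' then (1 : ℝ) else 0))
    (hχ' : ∀ B, χ' U B = w U B * ∏ b ∈ S, (if |ℓ b B| < r then (1 : ℝ) else 0))
    (hint : Integrable (D.integrand g U) (D.μ U))
    (hint' : Integrable (FluctData.integrand { D with χ := χ', χ_nonneg := h0, χ_le_one := h1 } g U) (D.μ U))
    (hmom : ∀ b ∈ S, Integrable (fun B => χ' U B * Real.exp (D.exponent g U B) * Real.exp (γ₂ / 2 * (ℓ b B) ^ 2)) (D.μ U))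
    (hpos : 0 < D.integral g U) :
    FluctData.newTerm { D with χ := χ', χ_nonneg := h0, χ_le_one := h1 } g U - D.newTerm g U ≤
      Real.exp (-(γ₂ / 2 * r' ^ 2)) *
        (∑ b ∈ S, ∫ B, χ' U B * Real.exp (D.exponent g U B) * Real.exp (γ₂ / 2 * (ℓ b B) ^ 2) ∂(D.μ U)) /
        D.integral g U := by
  -- the narrower window is the wider one times the product cut-off at radius r′
  have hnest : ∀ B, D.χ U B = χ' U B * ∏ b ∈ S, (if |ℓ b B| < r' then (1 : ℝ) else 0) := by
    intro B
    rw [hχ B, hχ' B, mul_assoc, ← Finset.prod_mul_distrib]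
    congr 1
    refine Finset.prod_congr rfl fun b _ => ?_
    by_cases h : |ℓ b B| < r'
    · simp [h, h.trans_le hrr]
    · simp [h]
  have hle : ∀ B, D.χ U B ≤ χ' U B := by
    intro B
    rw [hnest B]
    refine mul_le_of_le_one_right (h0 U B) (Finset.prod_le_one (fun b _ => by split_ifs <;> norm_num) fun b _ => ?_)
    split_ifs <;> norm_num
  exact newTerm_sub_newTerm_le_largeField D S ℓ hr' hγ χ' h0 h1 hint hint' hmom hpos hle
    (gap_of_nested_product D S ℓ r' χ' h0 hnest)

end Radius

end Literature.MathematicalPhysics.QuantumFieldTheory.Balaban1983to89.B12Eq213CutoffDependence
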